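import Summits.BirchSwinnertonDyer.Rank1Residual.Additive.QuadraticBranchRankOneLinkOfReadings
import Summits.BirchSwinnertonDyer.Rank1Residual.Additive.QuadraticBranchLowerHalfOfReadings
import Literature.NumberTheory.EllipticCurves.ModularCurvePeriodRatio
import Literature.NumberTheory.EllipticCurves.SupersingularIrreducibleProofs
import HarnessLib

/-!
# The `p`-integral period-ratio binder `hper` of the quadratic-branch chain, at `p ≡ 1 (mod 4)`, from
# the tree's NAMED FACT `realPeriodRat_eq_unit_mul_plusPeriod` (Greenberg–Vatsal Rem. 3.4 + the Manin
# constant at `p ∤ N` + Edixhoven Prop. 2) and Serre's irreducibility at a supersingular prime — and the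
# pair-level consumers ((C2_η) link, `MissingLowerBoundAt`, `BSDp`) with that binder DISCHARGED
# (cell `b2b-bsdres`, lane CLASS-CLOSURE §3.14, seat x1b GEN 45, file 129; bookkeeping over the tree's
# theorems and ONE existing named fact taken as a hypothesis; nothing asserted, nothing booked)

HONEST FRAMING (cell `b2b-bsdres`, run/shared/lean/b2b/bsd-rank1-residual/, verbatim in every
file): the goal of the cell is to DELETE the COMBINATION-SHAPED residual classes of the
Birch–Swinnerton-Dyer formula for ALL analytic-rank `≤ 1` elliptic curves over `ℚ` — "full BSD
formula for every rank `≤ 1` curve in class `C`" assembled STRICTLY from published theorems — so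
that the rank-`≤ 1` remainder becomes exactly the CONSTRUCTION-SHAPED classes, which are TYPED
(missing-input `Prop`s), NOT attempted. This is not "finishing BSD". Research route; NO CLAIM BEYOND
STATED CLASSES; the classes served (O10-PS = X12 ∩ CM-inert ∩ Kodaira `I₀*`; O5a / O7-ss ∩ `e = 2`)
stay CONSTRUCTION-SHAPED and OPEN; nothing here changes a label or a mark; census / instrument output
is EVIDENCE, never a Literature fact. THEOREMS ONLY (0 definitions, 0 named facts minted, 0 `sorry`):
every conclusion is CONDITIONAL on its displayed hypotheses — the typed `@[conjecture]` items (C1_η)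
`QuadraticBranchPlusMainConjectureAt` and C-cc-1 = (C2_η-GZ) `QuadraticBranchPAdicGrossZagierValuationAt`
appear ONLY as hypotheses and are NOT claimed; the named fact `realPeriodRat_eq_unit_mul_plusPeriod`
(`Literature/NumberTheory/EllipticCurves/ModularCurvePeriodRatio.lean`; "Size L; no `_holds`") is
TAKEN AS A HYPOTHESIS `hGV` (conditional result), never asserted.

PARTITION (D-0054): CornerF inert-bad sub-cell (B12 / O10; O10-PS `e = 2`) and EXCLUDED-DOMAIN
non-CM additive `p` with a good `a_p = 0` `p*`-twin (O5a / O7-ss ∩ `e = 2`) × the rank-one pairs of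
those families with `p ≡ 1 (mod 4)` × `p ≥ 5` — types-the-object-of / none: removes the displayed
period-ratio binder `hper` at `p ≡ 1 (mod 4)` modulo ONE existing named fact; closes no cell, books
nothing, moves no mark.

## What (x1b GEN 45, file 129)

Every pair-level consumer of the chain [124] / [126] / [128] (`…LevelBridge.bsdp_of_plusMC_…_of_readings`,
`…missingLowerBoundAt_…_of_lowerReading`, `…quadraticBranchRankOneLinkAt_…_of_readings_of_periodRatio`)
and the class node of cell bsd-cm (`X12/ClassClosureO10Refined.lean`, `hdata`) display ONE analytic
existence binder, reduced by bsd-potss-ctrl's `quadraticBranch_hdata_of_periodRatio` (Kobayashi Thm.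
3.2 = Pollack) to the `p`-INTEGRAL PERIOD RATIO `hper`: for every globally minimal `V` with good
reduction at `p` and `a_p(V) = 0` and its newform `f`, `∃ ϖ ∈ ℚ`, `‖ϖ‖_p ≤ 1`, with
`ϖ · Ω_V^+ = Ω_f^+` if `η = ω^{(p−1)/2}` is even (`p ≡ 1 (mod 4)`: `p* = p > 0`, the twist `W` is by a
REAL field, real periods) resp. `ϖ · Ω_V^− = Ω_f^−` if `η` is odd (`p ≡ 3 (mod 4)`). Here:
* §1 `exists_padicNorm_eq_one_mul_realPeriodRat_eq_plusPeriod_of_goodSupersingular` — for EVERY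
  globally minimal `V/ℚ`, `p ≥ 5` good with `a_p(V) = 0`, and its newform `f`: `∃ ϖ ∈ ℚ`,
  `‖ϖ‖_p = 1`, `ϖ · Ω_V^+ = Ω_f^+` — GIVEN the named fact `hGV : realPeriodRat_eq_unit_mul_plusPeriod`
  (whose hypothesis "`E[p]` irreducible" is DISCHARGED: `a_p = 0`, `p` odd good ⟹ `ρ̄_{V,p}`
  irreducible, Serre 1972 §1.11 Prop. 12, tree theorem `hasIrreducibleModPGaloisRep_of_dvd_frobeniusTrace`;
  `ϖ = u⁻¹` for the fact's unit `u`);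
* §1 `periodRatio_of_realPeriodRat_eq_unit_mul_plusPeriod_of_even` — hence, at `p ≡ 1 (mod 4)`
  (`Even (p / 2)`), VERBATIM the binder `hper`; §2 `quadraticBranch_hdata_of_realPeriodRat_eq_unit_mul_plusPeriod_of_even`
  — VERBATIM the binder `hdata` of [124]/[126]/[128] and of the bsd-cm class node;
* §3 pair-level consumers with the period binder GONE at `p ≡ 1 (mod 4)` (hypothesis `hGV` instead), and
  — for every odd `p ≥ 5` — the INTRINSIC pair-level forms with `hper` displayed (the pair data of [124]
  PRODUCED by [128] §1 `exists_pairData_of_quadraticTwist_goodSupersingular`):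
  `bsdp_of_plusMC_of_pAdicGrossZagierValuation_of_readings_of_periodRatio` /
  `…_of_namedPeriodFact`, `missingLowerBoundAt_of_plusMC_of_pAdicGrossZagierValuation_of_lowerReading_of_periodRatio`
  / `…_of_namedPeriodFact`, `quadraticBranchRankOneLinkAt_of_pAdicGrossZagierValuation_of_readings_of_namedPeriodFact`.
NET for the ledgers (nothing booked; no mark / label / tier / count moves): at `p ≡ 1 (mod 4)`, `p ≥ 5`,
the O10-PS / O7-ss ∩ `e = 2` pair-level chain displays NO analytic datum any more — its inputs are
(C1_η) [conjecture in print] + C-cc-1 [EVIDENCE item] + the readings ((R2)/hKO, h74x/h74l) + NAMED FACTS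
(hmod, hGZ, hGZK, hPT, hnf, and now hGV). At `p ≡ 3 (mod 4)` the binder `hper` (imaginary period
`Ω_V^−` versus `Ω_f^−`) STAYS displayed: the tree holds NO named fact comparing `Ω^−(E)` with the
minus lattice period of the newform (the sources of `hGV` — Edixhoven Prop. 2 `Λ(ω_{E₀}) = c₀ Λ_f` as
LATTICES, the Manin constant at `p ∤ N`, Greenberg–Vatsal Rem. 3.4's isogeny step — give it by the same
argument; vending it is the literature seat's call, asked in the cell INBOX; NOT stated here).

References (locators only): [GreenbergVatsal2000] §3 Rem. 3.4; [AbbesUllmo1996] Thm. A; [Mazur1978]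
Cor. 4.1; [EdixhovenManin1991] Prop. 2, §1; [Serre1972] §1.11 Prop. 12; [Kobayashi2003] Thm. 3.2
(p. 7), §4 (p. 8), Thm. 7.4 (p. 13); [KitajimaOtsuki2018] Main Thm. 1.3, Def. 2.1; [Miller2011LMS] §1,
Def. 1.1; [GrossZagier1986] Thm. I.(7.3).
-/

noncomputable section

open scoped Classical MatrixGroups ModularForm NumberField

open CongruenceSubgroup WeierstrassCurve Literature.NumberTheory.EllipticCurves
  Literature.NumberTheory.EllipticCurves.ModularForms
  Literature.NumberTheory.EllipticCurves.Kobayashi2003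
  Literature.NumberTheory.EllipticCurves.Rank1Residual
  Literature.NumberTheory.EllipticCurves.Rank1Residual.Typed
  Literature.NumberTheory.GaloisRepresentations
  Literature.NumberTheory.GaloisCohomology
  Literature.NumberTheory.EllipticCurves.IwasawaAlgebra

namespace Summit.BirchSwinnertonDyer.Rank1Residual.Additive

/-! ## §1 The plus period ratio of a good `a_p = 0` curve from the named fact -/

section PeriodRatio

variable (p : ℕ) [hp : Fact p.Prime]

/-- **`∃ ϖ ∈ ℚ`, `‖ϖ‖_p = 1`, `ϖ · Ω_V^+ = Ω_f^+` for every globally minimal `V/ℚ` with good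
reduction at `p ≥ 5` and `a_p(V) = 0`**, GIVEN the named fact
`hGV : realPeriodRat_eq_unit_mul_plusPeriod` ("`Ω(W) = u · Ω⁺_f`, `|u|_p = 1`, for `p ≥ 5` good with
`E[p]` irreducible": Greenberg–Vatsal 2000 §3 Rem. 3.4 with the Manin constant at `p ∤ N` —
Abbes–Ullmo Thm. A / Mazur Cor. 4.1 — and Edixhoven 1991 Prop. 2): the fact's irreducibility
hypothesis holds because `p` is an odd prime of good SUPERSINGULAR reduction (`a_p = 0`; Serre 1972
§1.11 Prop. 12, tree theorem `hasIrreducibleModPGaloisRep_of_dvd_frobeniusTrace`), and `ϖ = u⁻¹`.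
CONDITIONAL on `hGV` (named fact taken as a hypothesis; no `_holds` in the tree); nothing booked.
[cite: GreenbergVatsal2000, §3, Remark 3.4] [cite: AbbesUllmo1996, Thm. A] [cite: Mazur1978, Cor. 4.1]
[cite: EdixhovenManin1991, Prop. 2 and §1] [cite: Serre1972, §1.11 Prop. 12] -/
theorem exists_padicNorm_eq_one_mul_realPeriodRat_eq_plusPeriod_of_goodSupersingular
    (hGV : realPeriodRat_eq_unit_mul_plusPeriod) (hp5 : 5 ≤ p)
    (V : WeierstrassCurve ℚ) [V.IsElliptic] [V.IsGloballyMinimal]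
    {N : ℕ} [NeZero N] (f : CuspForm (Gamma0 N) 2) (hf : IsNewformOf V f)
    (hgood : V.HasGoodReductionAtPrime p) (hap : V.frobeniusTrace p = 0) :
    ∃ ϖ : ℚ, ‖(ϖ : ℚ_[p])‖ = 1 ∧ (ϖ : ℝ) * V.realPeriodRat = plusPeriod f := by
  have hp2 : p ≠ 2 := by omega
  have hirr : V.HasIrreducibleModPGaloisRep p :=
    hasIrreducibleModPGaloisRep_of_dvd_frobeniusTrace V p hp2
      (V.not_dvd_minimalDiscriminantInt_of_hasGoodReductionAtPrime' p hgood)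
      (by rw [hap]; exact dvd_zero _)
  obtain ⟨u, hu, hΩ⟩ := hGV V p hp5 hgood hirr f hf
  have hu0 : u ≠ 0 := by
    rintro rfl
    rw [Rat.cast_zero, norm_zero] at hu
    exact zero_ne_one hu
  refine ⟨u⁻¹, by rw [Rat.cast_inv, norm_inv, hu, inv_one], ?_⟩
  rw [hΩ, Rat.cast_inv, inv_mul_cancel_left₀ (Rat.cast_ne_zero.mpr hu0)]

/-- **The binder `hper` at `p ≡ 1 (mod 4)`** (`Even (p / 2)`, i.e. `η = ω^{(p−1)/2}` even, `p* = p`):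
for every globally minimal `V` with good reduction at `p ≥ 5` and `a_p(V) = 0` and its newform `f`,
`∃ ϖ ∈ ℚ` with `‖ϖ‖_p ≤ 1` and the parity-selected period relation — VERBATIM the hypothesis `hper`
of `quadraticBranch_hdata_of_periodRatio` and of [128]'s `…_of_periodRatio` consumer — GIVEN the
named fact `hGV`. (At `p ≡ 3 (mod 4)` the relation concerns `Ω_V^−` / `Ω_f^−`, for which the tree has
no named fact; not covered.) CONDITIONAL on `hGV`; nothing booked.
[cite: GreenbergVatsal2000, §3, Remark 3.4] [cite: EdixhovenManin1991, Prop. 2 and §1]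
[cite: Serre1972, §1.11 Prop. 12] -/
theorem periodRatio_of_realPeriodRat_eq_unit_mul_plusPeriod_of_even
    (hGV : realPeriodRat_eq_unit_mul_plusPeriod) (hp5 : 5 ≤ p) (heven : Even (p / 2)) :
    ∀ (V : WeierstrassCurve ℚ) [V.IsElliptic] [V.IsGloballyMinimal]
      {N : ℕ} [NeZero N] (f : CuspForm (Gamma0 N) 2), IsNewformOf V f →
      V.HasGoodReductionAtPrime p → V.frobeniusTrace p = 0 →
      ∃ ϖ : ℚ, ‖(ϖ : ℚ_[p])‖ ≤ 1 ∧
        (if Even (p / 2) then (ϖ : ℝ) * V.realPeriodRat = plusPeriod f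
          else (ϖ : ℝ) * V.imaginaryPeriodRat = minusPeriod f) := by
  intro V _ _ N _ f hf hgood hap
  obtain ⟨ϖ, hϖ, hrel⟩ :=
    exists_padicNorm_eq_one_mul_realPeriodRat_eq_plusPeriod_of_goodSupersingular p hGV hp5 V f hf
      hgood hap
  exact ⟨ϖ, hϖ.le, by rw [if_pos heven]; exact hrel⟩

/-! ## §2 The analytic existence binder `hdata` at `p ≡ 1 (mod 4)` -/

/-- **The binder `hdata` of [124] / [126] / [128] and of the bsd-cm class node at `p ≡ 1 (mod 4)`**:
for every globally minimal good `a_p = 0` curve `V` at `p ≥ 5` and its newform `f`, a rational `ϖ`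
with the (plus) period relation AND a branch function `L` with `IsQuadraticBranchMinusLFunction f p ϖ L`
— §1 composed with bsd-potss-ctrl's `quadraticBranch_hdata_of_periodRatio` (Kobayashi Thm. 3.2 =
Pollack: existence of `L_p⁻(V, η, X)` for a `p`-integral `ϖ`). CONDITIONAL on `hGV`; nothing booked.
[cite: Kobayashi2003, Thm. 3.2, (3.5) and (3.7) (p. 7)] [cite: Pollack2003, Thm. 5.6 and Prop. 6.18]
[cite: GreenbergVatsal2000, §3, Remark 3.4] -/
theorem quadraticBranch_hdata_of_realPeriodRat_eq_unit_mul_plusPeriod_of_even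
    (hGV : realPeriodRat_eq_unit_mul_plusPeriod) (hp5 : 5 ≤ p) (heven : Even (p / 2)) :
    ∀ (V : WeierstrassCurve ℚ) [V.IsElliptic] [V.IsGloballyMinimal]
      {N : ℕ} [NeZero N] (f : CuspForm (Gamma0 N) 2), IsNewformOf V f →
      V.HasGoodReductionAtPrime p → V.frobeniusTrace p = 0 →
      ∃ ϖ : ℚ, (if Even (p / 2) then (ϖ : ℝ) * V.realPeriodRat = plusPeriod f
          else (ϖ : ℝ) * V.imaginaryPeriodRat = minusPeriod f) ∧
        ∃ L : IwasawaAlgebra p, IsQuadraticBranchMinusLFunction f p ϖ L :=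
  quadraticBranch_hdata_of_periodRatio (by omega)
    (periodRatio_of_realPeriodRat_eq_unit_mul_plusPeriod_of_even p hGV hp5 heven)

end PeriodRatio

/-! ## §3 Pair-level consumers: INTRINSIC forms (`hper` displayed, any odd `p ≥ 5`) and the forms with
the period binder DISCHARGED by the named fact (`p ≡ 1 (mod 4)`) -/

namespace LevelBridge

variable (W : WeierstrassCurve ℚ) [W.IsElliptic] [W.IsGloballyMinimal] (p : ℕ) [hp : Fact p.Prime]

/-- **INTRINSIC pair-level `BSD(W, p)` from (C1_η) ∧ C-cc-1 with the analytic binder REDUCED to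
`hper`** (any odd `p ≥ 5`): for `W` of analytic rank one with a globally minimal `p*`-twin model `V`
(`C • W^{(p*)} = V`) good at `p` with `a_p(V) = 0`: `BSDp W p` ⟸ C-cc-1 at `(W, p)` (`h2`) ∧ (C1_η) at
`V` (`h1`), GIVEN hmod/hGZ/hGZK/hPT/hnf, the `p`-integral period-ratio binder `hper`, the reading (R2)
and the exact odd-`η` reading `h74x`. The pair data of [124] (newform, `ϖ`, `L`, `W(ℚ_p)[p] = 0`,
generator of exact level) are PRODUCED ([128] §1 + `quadraticBranch_hdata_of_periodRatio`).
CONDITIONAL on every displayed hypothesis; C-cc-1 and (C1_η) NOT claimed; nothing booked; O10 / O7-ss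
stay OPEN. [cite: Kobayashi2003, Thm. 3.2 (p. 7), §4 (p. 8), Thm. 7.4 (p. 13), Thm. 9.3 (p. 26)]
[cite: KitajimaOtsuki2018, Main Thm. 1.3 (= Thm. 4.8) with Def. 2.1] [cite: Miller2011LMS, §1 and Def. 1.1]
[cite: GrossZagier1986, Thm. I.(7.3) (p. 230)] -/
theorem bsdp_of_plusMC_of_pAdicGrossZagierValuation_of_readings_of_periodRatio
    (hmod : hasEntireLFunction_rat) (hGZ : GrossZagier1986_thm_I_7_3)
    (hGZK : rank_eq_analyticRank_of_analyticRank_le_one)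
    (hPT : poitouTate_selmerStructure_duality_real ℚ) (hnf : exists_isNewformOf)
    (hper : ∀ (V : WeierstrassCurve ℚ) [V.IsElliptic] [V.IsGloballyMinimal]
      {N : ℕ} [NeZero N] (f : CuspForm (Gamma0 N) 2), IsNewformOf V f →
      V.HasGoodReductionAtPrime p → V.frobeniusTrace p = 0 →
      ∃ ϖ : ℚ, ‖(ϖ : ℚ_[p])‖ ≤ 1 ∧
        (if Even (p / 2) then (ϖ : ℝ) * V.realPeriodRat = plusPeriod f
          else (ϖ : ℝ) * V.imaginaryPeriodRat = minusPeriod f))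
    (hR2 : OddBranchStrictMinusNoFiniteSubmoduleAt W p)
    (h74x : ∀ (V : WeierstrassCurve ℚ) [V.IsElliptic] [V.IsGloballyMinimal] (C : VariableChange ℚ)
        {N : ℕ} [NeZero N] {f : CuspForm (Gamma0 N) 2},
        p ≠ 2 → C • W.quadraticTwist ((-1) ^ (p / 2) * p) = V →
        V.HasGoodReductionAtPrime p → V.frobeniusTrace p = 0 →
        QuadraticBranchPlusMainConjectureAt V p → IsNewformOf V f →
        ∀ (ϖ : ℚ), (if Even (p / 2) then (ϖ : ℝ) * V.realPeriodRat = plusPeriod f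
            else (ϖ : ℝ) * V.imaginaryPeriodRat = minusPeriod f) →
        ∀ (Lη : IwasawaAlgebra p), IsQuadraticBranchMinusLFunction f p ϖ Lη →
        ∀ (κ : ZpExtension ℚ p) (γ : Field.absoluteGaloisGroup ℚ),
          κ.IsCyclotomic → κ.IsTopGenerator γ → IsCyclotomicVariable p γ →
        ∀ (D : StrictSignedSelmerDualData W κ ℚ_[p] γ (-1)) (L' : IwasawaAlgebra p),
          Lη = PowerSeries.X * L' → D.charIdeal = Ideal.span {L'})
    (h2 : QuadraticBranchPAdicGrossZagierValuationAt W p)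
    {V : WeierstrassCurve ℚ} [V.IsElliptic] [V.IsGloballyMinimal] {C : VariableChange ℚ}
    (hp5 : 5 ≤ p) (hC : C • W.quadraticTwist ((-1) ^ (p / 2) * p) = V)
    (hgood : V.HasGoodReductionAtPrime p) (hap : V.frobeniusTrace p = 0)
    (h1 : QuadraticBranchPlusMainConjectureAt V p) (hr : W.analyticRank = 1) : BSDp W p := by
  obtain ⟨N, _, f, ϖ, L, P, n, hf, hϖ, hL, htors, hP, hgen, hdiv, hndiv⟩ :=
    exists_pairData_of_quadraticTwist_goodSupersingular W p hGZK hnf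
      (quadraticBranch_hdata_of_periodRatio (by omega) hper) hp5 hC hgood hap hr
  exact bsdp_of_plusMC_of_pAdicGrossZagierValuation_of_readings W p hmod hGZ hGZK hPT hR2 h74x
    ((quadraticBranchPAdicGrossZagierValuationAt_iff W p).mp h2) hp5 hC hgood hap h1 hf hϖ hL htors hP
    hgen hdiv hndiv hr

/-- **Pair-level `BSD(W, p)` from (C1_η) ∧ C-cc-1 at `p ≡ 1 (mod 4)` with NO analytic datum displayed**:
the previous theorem with `hper` DISCHARGED by the named fact `hGV : realPeriodRat_eq_unit_mul_plusPeriod`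
(§1). Inputs: (C1_η) at `V`, C-cc-1 at `(W, p)`, the named facts hmod/hGZ/hGZK/hPT/hnf/hGV, the reading
(R2) and the exact odd-`η` reading `h74x`; `W` of analytic rank one, `V` a globally minimal good
`a_p = 0` model of `W^{(p)}`, `p ≥ 5`, `p ≡ 1 (mod 4)`. CONDITIONAL on every displayed hypothesis;
C-cc-1 and (C1_η) NOT claimed; nothing booked; O10 / O7-ss stay OPEN.
[cite: GreenbergVatsal2000, §3, Remark 3.4] [cite: Kobayashi2003, Thm. 3.2 (p. 7), §4 (p. 8), Thm. 7.4 (p. 13)]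
[cite: KitajimaOtsuki2018, Main Thm. 1.3 (= Thm. 4.8) with Def. 2.1] [cite: Miller2011LMS, §1 and Def. 1.1] -/
theorem bsdp_of_plusMC_of_pAdicGrossZagierValuation_of_readings_of_namedPeriodFact
    (hmod : hasEntireLFunction_rat) (hGZ : GrossZagier1986_thm_I_7_3)
    (hGZK : rank_eq_analyticRank_of_analyticRank_le_one)
    (hPT : poitouTate_selmerStructure_duality_real ℚ) (hnf : exists_isNewformOf)
    (hGV : realPeriodRat_eq_unit_mul_plusPeriod)
    (hR2 : OddBranchStrictMinusNoFiniteSubmoduleAt W p)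
    (h74x : ∀ (V : WeierstrassCurve ℚ) [V.IsElliptic] [V.IsGloballyMinimal] (C : VariableChange ℚ)
        {N : ℕ} [NeZero N] {f : CuspForm (Gamma0 N) 2},
        p ≠ 2 → C • W.quadraticTwist ((-1) ^ (p / 2) * p) = V →
        V.HasGoodReductionAtPrime p → V.frobeniusTrace p = 0 →
        QuadraticBranchPlusMainConjectureAt V p → IsNewformOf V f →
        ∀ (ϖ : ℚ), (if Even (p / 2) then (ϖ : ℝ) * V.realPeriodRat = plusPeriod f
            else (ϖ : ℝ) * V.imaginaryPeriodRat = minusPeriod f) →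
        ∀ (Lη : IwasawaAlgebra p), IsQuadraticBranchMinusLFunction f p ϖ Lη →
        ∀ (κ : ZpExtension ℚ p) (γ : Field.absoluteGaloisGroup ℚ),
          κ.IsCyclotomic → κ.IsTopGenerator γ → IsCyclotomicVariable p γ →
        ∀ (D : StrictSignedSelmerDualData W κ ℚ_[p] γ (-1)) (L' : IwasawaAlgebra p),
          Lη = PowerSeries.X * L' → D.charIdeal = Ideal.span {L'})
    (h2 : QuadraticBranchPAdicGrossZagierValuationAt W p)
    {V : WeierstrassCurve ℚ} [V.IsElliptic] [V.IsGloballyMinimal] {C : VariableChange ℚ}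
    (hp5 : 5 ≤ p) (heven : Even (p / 2)) (hC : C • W.quadraticTwist ((-1) ^ (p / 2) * p) = V)
    (hgood : V.HasGoodReductionAtPrime p) (hap : V.frobeniusTrace p = 0)
    (h1 : QuadraticBranchPlusMainConjectureAt V p) (hr : W.analyticRank = 1) : BSDp W p :=
  bsdp_of_plusMC_of_pAdicGrossZagierValuation_of_readings_of_periodRatio W p hmod hGZ hGZK hPT hnf
    (periodRatio_of_realPeriodRat_eq_unit_mul_plusPeriod_of_even p hGV hp5 heven) hR2 h74x h2 hp5 hC
    hgood hap h1 hr

/-- **INTRINSIC pair-level LOWER half `MissingLowerBoundAt W p` from the LOWER inclusion `h74l` of the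
odd main conjecture at `η` ∧ C-cc-1, with the analytic binder REDUCED to `hper`** (any odd `p ≥ 5`;
NO Kitajima–Otsuki input): [126]'s `…missingLowerBoundAt_of_plusMC_of_pAdicGrossZagierValuation_of_lowerReading`
on the PRODUCED pair data. CONDITIONAL on every displayed hypothesis; C-cc-1 and (C1_η) NOT claimed;
nothing booked; O10 / O7-ss stay OPEN.
[cite: Kobayashi2003, Thm. 3.2 (p. 7), §4 (p. 8), Thm. 7.4 (p. 13)] [cite: GreenbergLNM1716, Lemma 4.2 (p. 102)]
[cite: Miller2011LMS, §1 and Def. 1.1] [cite: GrossZagier1986, Thm. I.(7.3) (p. 230)] -/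
theorem missingLowerBoundAt_of_plusMC_of_pAdicGrossZagierValuation_of_lowerReading_of_periodRatio
    (hmod : hasEntireLFunction_rat) (hGZ : GrossZagier1986_thm_I_7_3)
    (hGZK : rank_eq_analyticRank_of_analyticRank_le_one)
    (hPT : poitouTate_selmerStructure_duality_real ℚ) (hnf : exists_isNewformOf)
    (hper : ∀ (V : WeierstrassCurve ℚ) [V.IsElliptic] [V.IsGloballyMinimal]
      {N : ℕ} [NeZero N] (f : CuspForm (Gamma0 N) 2), IsNewformOf V f →
      V.HasGoodReductionAtPrime p → V.frobeniusTrace p = 0 →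
      ∃ ϖ : ℚ, ‖(ϖ : ℚ_[p])‖ ≤ 1 ∧
        (if Even (p / 2) then (ϖ : ℝ) * V.realPeriodRat = plusPeriod f
          else (ϖ : ℝ) * V.imaginaryPeriodRat = minusPeriod f))
    (h74l : ∀ (V : WeierstrassCurve ℚ) [V.IsElliptic] [V.IsGloballyMinimal] (C : VariableChange ℚ)
        {N : ℕ} [NeZero N] {f : CuspForm (Gamma0 N) 2},
        p ≠ 2 → C • W.quadraticTwist ((-1) ^ (p / 2) * p) = V →
        V.HasGoodReductionAtPrime p → V.frobeniusTrace p = 0 →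
        QuadraticBranchPlusMainConjectureAt V p → IsNewformOf V f →
        ∀ (ϖ : ℚ), (if Even (p / 2) then (ϖ : ℝ) * V.realPeriodRat = plusPeriod f
            else (ϖ : ℝ) * V.imaginaryPeriodRat = minusPeriod f) →
        ∀ (Lη : IwasawaAlgebra p), IsQuadraticBranchMinusLFunction f p ϖ Lη →
        ∀ (κ : ZpExtension ℚ p) (γ : Field.absoluteGaloisGroup ℚ),
          κ.IsCyclotomic → κ.IsTopGenerator γ → IsCyclotomicVariable p γ →
        ∀ (D : StrictSignedSelmerDualData W κ ℚ_[p] γ (-1)) (L' : IwasawaAlgebra p),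
          Lη = PowerSeries.X * L' → D.charIdeal ≤ Ideal.span {L'})
    (h2 : QuadraticBranchPAdicGrossZagierValuationAt W p)
    {V : WeierstrassCurve ℚ} [V.IsElliptic] [V.IsGloballyMinimal] {C : VariableChange ℚ}
    (hp5 : 5 ≤ p) (hC : C • W.quadraticTwist ((-1) ^ (p / 2) * p) = V)
    (hgood : V.HasGoodReductionAtPrime p) (hap : V.frobeniusTrace p = 0)
    (h1 : QuadraticBranchPlusMainConjectureAt V p) (hr : W.analyticRank = 1) :
    MissingLowerBoundAt W p := by
  obtain ⟨N, _, f, ϖ, L, P, n, hf, hϖ, hL, htors, hP, hgen, hdiv, hndiv⟩ :=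
    exists_pairData_of_quadraticTwist_goodSupersingular W p hGZK hnf
      (quadraticBranch_hdata_of_periodRatio (by omega) hper) hp5 hC hgood hap hr
  exact missingLowerBoundAt_of_plusMC_of_pAdicGrossZagierValuation_of_lowerReading W p hmod hGZ hGZK
    hPT h74l ((quadraticBranchPAdicGrossZagierValuationAt_iff W p).mp h2) hp5 hC hgood hap h1 hf hϖ hL
    htors hP hgen hdiv hndiv hr

/-- **Pair-level LOWER half at `p ≡ 1 (mod 4)` with NO analytic datum displayed**: the previous theorem
with `hper` DISCHARGED by the named fact `hGV` (§1). Inputs: the LOWER inclusion `h74l` under (C1_η) at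
`V`, C-cc-1 at `(W, p)`, hmod/hGZ/hGZK/hPT/hnf/hGV; NO Kitajima–Otsuki input. CONDITIONAL on every
displayed hypothesis; nothing booked; O10 / O7-ss stay OPEN.
[cite: GreenbergVatsal2000, §3, Remark 3.4] [cite: Kobayashi2003, Thm. 3.2 (p. 7), §4 (p. 8), Thm. 7.4 (p. 13)]
[cite: Miller2011LMS, §1 and Def. 1.1] -/
theorem missingLowerBoundAt_of_plusMC_of_pAdicGrossZagierValuation_of_lowerReading_of_namedPeriodFact
    (hmod : hasEntireLFunction_rat) (hGZ : GrossZagier1986_thm_I_7_3)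
    (hGZK : rank_eq_analyticRank_of_analyticRank_le_one)
    (hPT : poitouTate_selmerStructure_duality_real ℚ) (hnf : exists_isNewformOf)
    (hGV : realPeriodRat_eq_unit_mul_plusPeriod)
    (h74l : ∀ (V : WeierstrassCurve ℚ) [V.IsElliptic] [V.IsGloballyMinimal] (C : VariableChange ℚ)
        {N : ℕ} [NeZero N] {f : CuspForm (Gamma0 N) 2},
        p ≠ 2 → C • W.quadraticTwist ((-1) ^ (p / 2) * p) = V →
        V.HasGoodReductionAtPrime p → V.frobeniusTrace p = 0 →
        QuadraticBranchPlusMainConjectureAt V p → IsNewformOf V f →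
        ∀ (ϖ : ℚ), (if Even (p / 2) then (ϖ : ℝ) * V.realPeriodRat = plusPeriod f
            else (ϖ : ℝ) * V.imaginaryPeriodRat = minusPeriod f) →
        ∀ (Lη : IwasawaAlgebra p), IsQuadraticBranchMinusLFunction f p ϖ Lη →
        ∀ (κ : ZpExtension ℚ p) (γ : Field.absoluteGaloisGroup ℚ),
          κ.IsCyclotomic → κ.IsTopGenerator γ → IsCyclotomicVariable p γ →
        ∀ (D : StrictSignedSelmerDualData W κ ℚ_[p] γ (-1)) (L' : IwasawaAlgebra p),
          Lη = PowerSeries.X * L' → D.charIdeal ≤ Ideal.span {L'})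
    (h2 : QuadraticBranchPAdicGrossZagierValuationAt W p)
    {V : WeierstrassCurve ℚ} [V.IsElliptic] [V.IsGloballyMinimal] {C : VariableChange ℚ}
    (hp5 : 5 ≤ p) (heven : Even (p / 2)) (hC : C • W.quadraticTwist ((-1) ^ (p / 2) * p) = V)
    (hgood : V.HasGoodReductionAtPrime p) (hap : V.frobeniusTrace p = 0)
    (h1 : QuadraticBranchPlusMainConjectureAt V p) (hr : W.analyticRank = 1) :
    MissingLowerBoundAt W p :=
  missingLowerBoundAt_of_plusMC_of_pAdicGrossZagierValuation_of_lowerReading_of_periodRatio W p hmod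
    hGZ hGZK hPT hnf (periodRatio_of_realPeriodRat_eq_unit_mul_plusPeriod_of_even p hGV hp5 heven) h74l
    h2 hp5 hC hgood hap h1 hr

/-- **(C2_η) `QuadraticBranchRankOneLinkAt W p` at `p ≡ 1 (mod 4)` with NO analytic datum displayed**:
[128]'s `…_of_readings_of_periodRatio` with `hper` DISCHARGED by the named fact `hGV` (§1).
CONDITIONAL on every displayed hypothesis; C-cc-1 NOT claimed; nothing booked.
[cite: GreenbergVatsal2000, §3, Remark 3.4] [cite: BurungaleKobayashiOta2023, App. A Cor. A.5 (shape only)]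
[cite: Kobayashi2003, Thm. 3.2 (p. 7), §4 (p. 8), Thm. 7.4 (p. 13)] -/
theorem quadraticBranchRankOneLinkAt_of_pAdicGrossZagierValuation_of_readings_of_namedPeriodFact
    (hmod : hasEntireLFunction_rat) (hGZ : GrossZagier1986_thm_I_7_3)
    (hGZK : rank_eq_analyticRank_of_analyticRank_le_one)
    (hPT : poitouTate_selmerStructure_duality_real ℚ) (hnf : exists_isNewformOf)
    (hGV : realPeriodRat_eq_unit_mul_plusPeriod)
    (hR2 : OddBranchStrictMinusNoFiniteSubmoduleAt W p)
    (h74x : ∀ (V : WeierstrassCurve ℚ) [V.IsElliptic] [V.IsGloballyMinimal] (C : VariableChange ℚ)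
        {N : ℕ} [NeZero N] {f : CuspForm (Gamma0 N) 2},
        p ≠ 2 → C • W.quadraticTwist ((-1) ^ (p / 2) * p) = V →
        V.HasGoodReductionAtPrime p → V.frobeniusTrace p = 0 →
        QuadraticBranchPlusMainConjectureAt V p → IsNewformOf V f →
        ∀ (ϖ : ℚ), (if Even (p / 2) then (ϖ : ℝ) * V.realPeriodRat = plusPeriod f
            else (ϖ : ℝ) * V.imaginaryPeriodRat = minusPeriod f) →
        ∀ (Lη : IwasawaAlgebra p), IsQuadraticBranchMinusLFunction f p ϖ Lη →
        ∀ (κ : ZpExtension ℚ p) (γ : Field.absoluteGaloisGroup ℚ),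
          κ.IsCyclotomic → κ.IsTopGenerator γ → IsCyclotomicVariable p γ →
        ∀ (D : StrictSignedSelmerDualData W κ ℚ_[p] γ (-1)) (L' : IwasawaAlgebra p),
          Lη = PowerSeries.X * L' → D.charIdeal = Ideal.span {L'})
    (h2 : QuadraticBranchPAdicGrossZagierValuationAt W p) (hp5 : 5 ≤ p) (heven : Even (p / 2)) :
    QuadraticBranchRankOneLinkAt W p :=
  quadraticBranchRankOneLinkAt_of_pAdicGrossZagierValuation_of_readings_of_periodRatio W p hmod hGZ
    hGZK hPT hnf (periodRatio_of_realPeriodRat_eq_unit_mul_plusPeriod_of_even p hGV hp5 heven) hR2 h74x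
    h2 hp5

end LevelBridge

end Summit.BirchSwinnertonDyer.Rank1Residual.Additive

end
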